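import Literature.MathematicalPhysics.QuantumLattice.HubbardKuboKishiBounds
import Literature.MathematicalPhysics.QuantumLattice.HubbardGaugeBoundSharp
import Literature.MathematicalPhysics.QuantumLattice.ApproximatingHamiltonianProofs
import Literature.MathematicalPhysics.QuantumLattice.ReducedBCSTorus
import HarnessLib

/-!
# Kubo–Kishi's double commutator made explicit: the bond-kinetic `f`-sum identity

Kubo–Kishi (PRB 41 (1990) 4866, Remark 1, eq. (4)) transfer their Gaussian-domination bound on
the Duhamel function to the equal-time fluctuation through Falk–Bruch with a constant
`C_q ≥ ⟨(S_q, [H, S_{-q}])⟩` that is left unspecified beyond "bounded". This file EVALUATES the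
double commutator exactly, for the Hubbard Hamiltonian `H(t, U) - μ N` on any finite graph and
for every weighted number operator `Q = Σ_{x,σ} q_{xσ} n_{xσ}`:

* `weightedOrbNumber_comm_hop` — `[Q, c†_{xσ} c_{yσ}] = (q_{xσ} - q_{yσ}) c†_{xσ} c_{yσ}`;
* `weightedOrbNumber_comm_hamiltonianWith` — `[Q, H] = -t Σ_{x∼y,σ} (q_{xσ} - q_{yσ}) c†_{xσ} c_{yσ}`
  (the interaction and `μ N` commute with every `n_{xσ}`);
* `spinDensityField_doubleComm_eq`, `chargeDensityField_doubleComm_eq` — for the two Kubo–Kishi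
  fields `M_a = Σ a_x (n_{x↑} - n_{x↓})` and `D_a = Σ a_x (n_x - 1)` the Falk–Bruch double
  commutator is the bond-kinetic operator with squared-gradient weights,
  `M_a (H M_a - M_a H) - (H M_a - M_a H) M_a = t · T((a_x - a_y)²)`, `T(w) = hoppingForm G w`
  (the `f`-sum rule: both spin components carry `(a_x - a_y)²`);
* `re_gibbsState_spinDensityField_doubleComm_le`, `…charge…` — hence, with the SHARP hopping norm
  `‖c†_x c_y + c†_y c_x‖ ≤ 1` (`norm_hoppingForm_le_of_symm`),
  `Re ⟨[M_a, [H, M_a]]⟩_β ≤ |t| Σ_{x,y: x∼y} (a_x - a_y)²` (ordered pairs; `= 2|t| Σ_bonds (a_x-a_y)²`);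
* `kuboKishi_spin_sq_le_explicit`, `kuboKishi_charge_sq_le_explicit` — the FULLY EXPLICIT equal-time
  ceilings `⟨M_a²⟩_β ≤ ‖a‖²/(β|U|) + ½ √((‖a‖²/|U|) · |t| Σ_{x∼y} (a_x - a_y)²)` (attractive, any `μ`)
  and the same for `D_a` (repulsive, `μ = U/2`, bipartite), from the named Gaussian-domination facts;
* `kuboKishi_totalNumber_sq_le` — `a ≡ 1`: the gradient vanishes, `⟨(N - |Λ|)²⟩_β ≤ |Λ| T/U`
  (repulsive half-filled bipartite model: total-number fluctuations are `O(T/U)` per site);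
* `kuboKishi_staggered_charge_sq_le` — `a = ε` a bipartite sign: `(ε_x - ε_y)² = 4` on every bond, so on
  a graph of maximal degree `Δ`, `⟨D_ε²⟩_β / |Λ| ≤ T/U + √(Δ|t|/U)` — the `(π,…,π)` charge-density-wave
  structure factor of the half-filled repulsive model is `O(T/U + √(t/U))`, uniformly in the volume
  (Kubo–Kishi's Remark 3, quantitative; on `(ℤ/Lℤ)^d`, `Δ = 2d`).

* `kuboKishi_spin_twoProfile_sq_le`, `kuboKishi_charge_twoProfile_sq_le` — for ANY two profiles with
  `a_x² + b_x² = 1` (e.g. `cos(q·x)`, `sin(q·x)`): `⟨F_a² + F_b²⟩_β/|Λ| ≤ T/|U| + √(Δ|t|/|U|)`, i.e. the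
  `q`-dependent structure factors `4S^{zz}_β(q)` (attractive) and `S^{cc}_β(q)` (repulsive, half-filled,
  bipartite) are bounded UNIFORMLY in `q` by one explicit constant (KK Remarks 1, 3: no order at any `q`).

HONEST FRAMING (cell pub-hubbard, bounds): ceilings for a MODEL CLASS at `T > 0`; no claim on H/H₀,
no materials claim. The Gaussian-domination inputs stay the named facts
`kuboKishi_spin_gaussianDomination` / `kuboKishi_charge_gaussianDomination` of
`HubbardKuboKishiBounds.lean`; everything else here is proved.

References: K. Kubo, T. Kishi, Phys. Rev. B 41 (1990) 4866, Remark 1 eq. (4), Theorem 2, Remark 3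
[cite: KuboKishi1990]; F. J. Dyson, E. H. Lieb, B. Simon, J. Stat. Phys. 18 (1978) 335, Thm 3.1
[cite: DysonLiebSimon1978]; T. Koma, H. Tasaki, PRL 68 (1992) 3248, eq. (11) (the sharp hopping norm)
[cite: KomaTasakiPRL1992]; F. H. L. Essler, H. Frahm, F. Göhmann, A. Klümper, V. E. Korepin, *The
One-Dimensional Hubbard Model* (CUP 2005), eqs. (2.8), (2.72) (number/current-operator commutators)
[cite: EsslerEtAl2005].
-/

noncomputable section

namespace Literature.MathematicalPhysics.QuantumLattice

open Matrix Finset HubbardWave0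
open scoped Matrix.Norms.L2Operator ComplexOrder

/-! ### Weighted number operators and their commutators with a hop -/

section WeightedNumber

variable {Λ : Type*} [LinearOrder Λ] [Fintype Λ]

/-- The weighted number operator `Q_q = Σ_{x,σ} q(x,σ) n_{xσ}` (real weights).
[cite: KuboKishi1990, eq. (7)] -/
def weightedOrbNumber (q : Λ → Fin 2 → ℝ) : Matrix (Finset (Orb Λ)) (Finset (Orb Λ)) ℂ :=
  ∑ x : Λ, ∑ σ : Fin 2, (q x σ : ℂ) • numberOp x σ

/-- `[n_{zτ}, c†_{xσ} c_{yσ}] = (δ_{(z,τ),(x,σ)} - δ_{(z,τ),(y,σ)}) c†_{xσ} c_{yσ}` — the `j = k`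
case of the current-operator algebra. [cite: EsslerEtAl2005, eqs. (2.8) and (2.72)] -/
theorem numberOp_comm_hop (z x y : Λ) (τ σ : Fin 2) :
    numberOp z τ * (creation (orb x σ) * annihilation (orb y σ)) -
        creation (orb x σ) * annihilation (orb y σ) * numberOp z τ =
      (if σ = τ ∧ x = z then creation (orb x σ) * annihilation (orb y σ) else 0) -
        (if σ = τ ∧ y = z then creation (orb x σ) * annihilation (orb y σ) else 0) := by
  have h1 := numberOp_commutator_creation z x τ σ
  have h2 := numberOp_commutator_annihilation z y τ σ
  have e : numberOp z τ * (creation (orb x σ) * annihilation (orb y σ)) -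
        creation (orb x σ) * annihilation (orb y σ) * numberOp z τ =
      (numberOp z τ * creation (orb x σ) - creation (orb x σ) * numberOp z τ) *
          annihilation (orb y σ) +
        creation (orb x σ) *
          (numberOp z τ * annihilation (orb y σ) - annihilation (orb y σ) * numberOp z τ) := by
    noncomm_ring
  rw [e, h1, h2]
  split_ifs <;>
    simp only [Matrix.zero_mul, Matrix.mul_zero, Matrix.mul_neg, neg_zero, add_zero, zero_add,
      sub_zero, zero_sub, sub_self, add_neg_cancel]

/-- `Σ_{z,τ} δ_{(z,τ),(x,σ)} c_{zτ} A = c_{xσ} A`. [folklore] -/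
private theorem sum_sum_ite_and_eq {M : Type*} [AddCommMonoid M] (σ : Fin 2) (x : Λ)
    (f : Λ → Fin 2 → M) :
    ∑ z : Λ, ∑ τ : Fin 2, (if σ = τ ∧ x = z then f z τ else 0) = f x σ := by
  have h1 : ∀ z : Λ, z ≠ x → ∑ τ : Fin 2, (if σ = τ ∧ x = z then f z τ else 0) = 0 :=
    fun z hz => Finset.sum_eq_zero fun τ _ => if_neg fun h => hz h.2.symm
  rw [Finset.sum_eq_single_of_mem x (Finset.mem_univ _) fun z _ hz => h1 z hz]
  have h2 : ∀ τ : Fin 2, τ ≠ σ → (if σ = τ ∧ x = x then f x τ else 0) = 0 :=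
    fun τ hτ => if_neg fun h => hτ h.1.symm
  rw [Finset.sum_eq_single_of_mem σ (Finset.mem_univ _) fun τ _ hτ => h2 τ hτ]
  simp

/-- **`[Q_q, c†_{xσ} c_{yσ}] = (q_{xσ} - q_{yσ}) c†_{xσ} c_{yσ}`.** [cite: EsslerEtAl2005, eq. (2.72)] -/
theorem weightedOrbNumber_comm_hop (q : Λ → Fin 2 → ℝ) (x y : Λ) (σ : Fin 2) :
    weightedOrbNumber q * (creation (orb x σ) * annihilation (orb y σ)) -
        creation (orb x σ) * annihilation (orb y σ) * weightedOrbNumber q =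
      ((q x σ - q y σ : ℝ) : ℂ) • (creation (orb x σ) * annihilation (orb y σ)) := by
  set A : Matrix (Finset (Orb Λ)) (Finset (Orb Λ)) ℂ := creation (orb x σ) * annihilation (orb y σ)
  have e : weightedOrbNumber q * A - A * weightedOrbNumber q =
      ∑ z : Λ, ∑ τ : Fin 2, (q z τ : ℂ) • (numberOp z τ * A - A * numberOp z τ) := by
    simp only [weightedOrbNumber, Finset.sum_mul, Finset.mul_sum, Matrix.smul_mul, Matrix.mul_smul,
      smul_sub, Finset.sum_sub_distrib]
  have hz : ∀ (z : Λ) (τ : Fin 2), numberOp z τ * A - A * numberOp z τ =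
      (if σ = τ ∧ x = z then A else 0) - (if σ = τ ∧ y = z then A else 0) :=
    fun z τ => numberOp_comm_hop z x y τ σ
  rw [e]
  simp_rw [hz, smul_sub, Finset.sum_sub_distrib, smul_ite, smul_zero]
  rw [sum_sum_ite_and_eq σ x fun z τ => (q z τ : ℂ) • A,
    sum_sum_ite_and_eq σ y fun z τ => (q z τ : ℂ) • A, ← sub_smul, Complex.ofReal_sub]

/-- `Q_q` commutes with every number operator. [cite: EsslerEtAl2005, eq. (2.72)] -/
theorem weightedOrbNumber_commute_numberOp (q : Λ → Fin 2 → ℝ) (x : Λ) (σ : Fin 2) :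
    Commute (weightedOrbNumber q) (numberOp x σ) := by
  refine Commute.sum_left _ _ _ fun z _ => Commute.sum_left _ _ _ fun τ _ => ?_
  refine Commute.smul_left ?_ _
  rw [← numberAt_orb, ← numberAt_orb]
  exact numberAt_commute _ _

/-- `Q_q` commutes with the on-site repulsion `Σ_x n_{x↑} n_{x↓}`. [cite: EsslerEtAl2005, eq. (2.72)] -/
theorem weightedOrbNumber_commute_interaction (q : Λ → Fin 2 → ℝ) :
    Commute (weightedOrbNumber q)
      (∑ x : Λ, numberOp x 0 * numberOp x 1 : Matrix (Finset (Orb Λ)) (Finset (Orb Λ)) ℂ) := by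
  refine Commute.sum_right _ _ _ fun x _ => ?_
  exact Commute.mul_right (weightedOrbNumber_commute_numberOp q x 0)
    (weightedOrbNumber_commute_numberOp q x 1)

/-- `Q_q` commutes with the total particle number. [cite: EsslerEtAl2005, eq. (2.72)] -/
theorem weightedOrbNumber_commute_totalNumber (q : Λ → Fin 2 → ℝ) :
    Commute (weightedOrbNumber q) (totalNumber : Matrix (Finset (Orb Λ)) (Finset (Orb Λ)) ℂ) := by
  refine Commute.sum_right _ _ _ fun x _ => Commute.sum_right _ _ _ fun σ _ => ?_
  exact weightedOrbNumber_commute_numberOp q x σ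

variable (G : SimpleGraph Λ) [DecidableRel G.Adj]

/-- **`[Q_q, H] = -t Σ_{x∼y,σ} (q_{xσ} - q_{yσ}) c†_{xσ} c_{yσ}`** for `H = H(t,U) - μN`: the
interaction and the chemical-potential term commute with `Q_q`.
[cite: KuboKishi1990, Remark 1, eq. (4)] [cite: EsslerEtAl2005, eq. (2.72)] -/
theorem weightedOrbNumber_comm_hamiltonianWith (q : Λ → Fin 2 → ℝ) (t U μ : ℝ) :
    weightedOrbNumber q * hamiltonianWith G t U μ - hamiltonianWith G t U μ * weightedOrbNumber q =
      -(t : ℂ) • ∑ x : Λ, ∑ y : Λ, ∑ σ : Fin 2,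
        if G.Adj x y then ((q x σ - q y σ : ℝ) : ℂ) • (creation (orb x σ) * annihilation (orb y σ))
        else 0 := by
  have hI := (weightedOrbNumber_commute_interaction q).eq
  have hN := (weightedOrbNumber_commute_totalNumber q).eq
  rw [hamiltonianWith_eq, hamiltonian]
  simp only [Matrix.mul_add, Matrix.add_mul, Matrix.mul_sub, Matrix.sub_mul, Matrix.mul_smul,
    Matrix.smul_mul, hI, hN]
  simp only [Finset.mul_sum, Finset.sum_mul, Finset.smul_sum]
  have e : ∀ x y : Λ, ∀ σ : Fin 2,
      -(t : ℂ) • (weightedOrbNumber q * (if G.Adj x y then creation (orb x σ) * annihilation (orb y σ) else 0)) -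
        -(t : ℂ) • ((if G.Adj x y then creation (orb x σ) * annihilation (orb y σ) else 0) * weightedOrbNumber q) =
      -(t : ℂ) • (if G.Adj x y then ((q x σ - q y σ : ℝ) : ℂ) •
        (creation (orb x σ) * annihilation (orb y σ)) else 0) := by
    intro x y σ
    split_ifs with h
    · rw [← smul_sub, weightedOrbNumber_comm_hop]
    · simp
  simp_rw [← e]
  simp only [Finset.sum_sub_distrib]
  abel

/-- **The double commutator `[Q_q, [Q_q, H]] = -t Σ_{x∼y,σ} (q_{xσ} - q_{yσ})² c†_{xσ} c_{yσ}`.**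
[cite: KuboKishi1990, Remark 1, eq. (4)] -/
theorem weightedOrbNumber_doubleComm_hamiltonianWith (q : Λ → Fin 2 → ℝ) (t U μ : ℝ) :
    weightedOrbNumber q * (weightedOrbNumber q * hamiltonianWith G t U μ -
        hamiltonianWith G t U μ * weightedOrbNumber q) -
      (weightedOrbNumber q * hamiltonianWith G t U μ -
        hamiltonianWith G t U μ * weightedOrbNumber q) * weightedOrbNumber q =
      -(t : ℂ) • ∑ x : Λ, ∑ y : Λ, ∑ σ : Fin 2,
        if G.Adj x y then (((q x σ - q y σ) ^ 2 : ℝ) : ℂ) •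
          (creation (orb x σ) * annihilation (orb y σ)) else 0 := by
  rw [weightedOrbNumber_comm_hamiltonianWith]
  simp only [Matrix.mul_smul, Matrix.smul_mul, Finset.mul_sum, Finset.sum_mul, ← smul_sub,
    ← Finset.sum_sub_distrib]
  congr 1
  refine Finset.sum_congr rfl fun x _ => Finset.sum_congr rfl fun y _ =>
    Finset.sum_congr rfl fun σ _ => ?_
  split_ifs with h
  · rw [Matrix.mul_smul, Matrix.smul_mul, ← smul_sub, weightedOrbNumber_comm_hop, smul_smul,
      ← Complex.ofReal_mul, sq]
  · simp

/-- If the squared weight gradient is spin independent, `(q_{xσ} - q_{yσ})² = w(x,y)` on every bond,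
then the Falk–Bruch double commutator `Q (H Q - Q H) - (H Q - Q H) Q = [Q, [H, Q]]` is the bond-kinetic
operator `t · T(w)` (the `f`-sum rule behind Kubo–Kishi's constant `C_q`).
[cite: KuboKishi1990, Remark 1, eq. (4)] -/
theorem weightedOrbNumber_falkBruchComm_eq_hoppingForm (q : Λ → Fin 2 → ℝ) (w : Λ → Λ → ℝ)
    (hw : ∀ x y σ, G.Adj x y → (q x σ - q y σ) ^ 2 = w x y) (t U μ : ℝ) :
    weightedOrbNumber q * (hamiltonianWith G t U μ * weightedOrbNumber q -
        weightedOrbNumber q * hamiltonianWith G t U μ) -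
      (hamiltonianWith G t U μ * weightedOrbNumber q -
        weightedOrbNumber q * hamiltonianWith G t U μ) * weightedOrbNumber q =
      (t : ℂ) • hoppingForm G w := by
  have h := weightedOrbNumber_doubleComm_hamiltonianWith G q t U μ
  have e : weightedOrbNumber q * (hamiltonianWith G t U μ * weightedOrbNumber q -
        weightedOrbNumber q * hamiltonianWith G t U μ) -
      (hamiltonianWith G t U μ * weightedOrbNumber q -
        weightedOrbNumber q * hamiltonianWith G t U μ) * weightedOrbNumber q =
      -(weightedOrbNumber q * (weightedOrbNumber q * hamiltonianWith G t U μ -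
        hamiltonianWith G t U μ * weightedOrbNumber q) -
      (weightedOrbNumber q * hamiltonianWith G t U μ -
        hamiltonianWith G t U μ * weightedOrbNumber q) * weightedOrbNumber q) := by
    noncomm_ring
  rw [e, h, neg_smul, neg_neg, hoppingForm_eq]
  congr 1
  refine Finset.sum_congr rfl fun x _ => Finset.sum_congr rfl fun y _ =>
    Finset.sum_congr rfl fun σ _ => ?_
  split_ifs with hxy
  · rw [hw x y σ hxy]
  · rfl

end WeightedNumber

/-! ### The two Kubo–Kishi fields -/

section Fields

variable {Λ : Type*} [LinearOrder Λ] [Fintype Λ] (G : SimpleGraph Λ) [DecidableRel G.Adj]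

/-- `M_a = Q_q` with `q_{x↑} = a_x`, `q_{x↓} = -a_x`. [cite: KuboKishi1990, eq. (7)] -/
theorem spinDensityField_eq_weightedOrbNumber (a : Λ → ℝ) :
    spinDensityField a = weightedOrbNumber fun x σ => if σ = 0 then a x else -a x := by
  simp only [spinDensityField, weightedOrbNumber, Fin.sum_univ_two, Fin.isValue, if_true,
    show ((1 : Fin 2) = 0) = False by decide, if_false, smul_add, smul_neg,
    Complex.ofReal_neg, neg_smul, sub_eq_add_neg]

/-- `D_a = Q_q - (Σ_x a_x)·1` with `q_{xσ} = a_x`. [cite: KuboKishi1990, Theorem 2] -/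
theorem chargeDensityField_eq_weightedOrbNumber (a : Λ → ℝ) :
    chargeDensityField a = weightedOrbNumber (fun x _ => a x) - ((∑ x, a x : ℝ) : ℂ) • 1 := by
  simp only [chargeDensityField, weightedOrbNumber, Fin.sum_univ_two, Fin.isValue, smul_sub, smul_add,
    Finset.sum_sub_distrib, Finset.sum_add_distrib, Complex.ofReal_sum, Finset.sum_smul]

/-- A scalar shift does not change a commutator (right slot). [folklore] -/
private theorem comm_sub_smul_one_right (Q Y : Matrix (Finset (Orb Λ)) (Finset (Orb Λ)) ℂ) (c : ℂ) :
    Y * (Q - c • 1) - (Q - c • 1) * Y = Y * Q - Q * Y := by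
  simp only [Matrix.mul_sub, Matrix.sub_mul, Matrix.mul_smul, Matrix.smul_mul, Matrix.mul_one,
    Matrix.one_mul]
  abel

/-- A scalar shift does not change a commutator (left slot). [folklore] -/
private theorem comm_sub_smul_one_left (Q Y : Matrix (Finset (Orb Λ)) (Finset (Orb Λ)) ℂ) (c : ℂ) :
    (Q - c • 1) * Y - Y * (Q - c • 1) = Q * Y - Y * Q := by
  simp only [Matrix.mul_sub, Matrix.sub_mul, Matrix.mul_smul, Matrix.smul_mul, Matrix.mul_one,
    Matrix.one_mul]
  abel

/-- A scalar shift does not change the Falk–Bruch double commutator. [folklore] -/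
private theorem falkBruchComm_sub_smul_one (Q H : Matrix (Finset (Orb Λ)) (Finset (Orb Λ)) ℂ) (c : ℂ) :
    (Q - c • 1) * (H * (Q - c • 1) - (Q - c • 1) * H) - (H * (Q - c • 1) - (Q - c • 1) * H) * (Q - c • 1) =
      Q * (H * Q - Q * H) - (H * Q - Q * H) * Q := by
  rw [comm_sub_smul_one_right, comm_sub_smul_one_left]

/-- **The `f`-sum identity for the spin field**: `[M_a, [H, M_a]] = t · T((a_x - a_y)²)`, i.e.
`M_a (H M_a - M_a H) - (H M_a - M_a H) M_a = t Σ_{x∼y,σ} (a_x - a_y)² c†_{xσ} c_{yσ}` for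
`H = H(t,U) - μN` on any finite graph (both spin components carry `(a_x - a_y)²`).
[cite: KuboKishi1990, Remark 1, eq. (4)] -/
theorem spinDensityField_doubleComm_eq (a : Λ → ℝ) (t U μ : ℝ) :
    spinDensityField a * (hamiltonianWith G t U μ * spinDensityField a -
        spinDensityField a * hamiltonianWith G t U μ) -
      (hamiltonianWith G t U μ * spinDensityField a -
        spinDensityField a * hamiltonianWith G t U μ) * spinDensityField a =
      (t : ℂ) • hoppingForm G fun x y => (a x - a y) ^ 2 := by
  rw [spinDensityField_eq_weightedOrbNumber]
  exact weightedOrbNumber_falkBruchComm_eq_hoppingForm G (fun x σ => if σ = 0 then a x else -a x)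
    (fun x y => (a x - a y) ^ 2) (fun x y σ _ => by split_ifs <;> ring) t U μ

/-- **The `f`-sum identity for the charge field**: `[D_a, [H, D_a]] = t · T((a_x - a_y)²)`
(the constant `-Σ a_x` in `D_a` drops out of every commutator). [cite: KuboKishi1990, Theorem 2 and Remark 3] -/
theorem chargeDensityField_doubleComm_eq (a : Λ → ℝ) (t U μ : ℝ) :
    chargeDensityField a * (hamiltonianWith G t U μ * chargeDensityField a -
        chargeDensityField a * hamiltonianWith G t U μ) -
      (hamiltonianWith G t U μ * chargeDensityField a -
        chargeDensityField a * hamiltonianWith G t U μ) * chargeDensityField a =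
      (t : ℂ) • hoppingForm G fun x y => (a x - a y) ^ 2 := by
  rw [chargeDensityField_eq_weightedOrbNumber, falkBruchComm_sub_smul_one]
  exact weightedOrbNumber_falkBruchComm_eq_hoppingForm G (fun x _ => a x)
    (fun x y => (a x - a y) ^ 2) (fun x y σ _ => rfl) t U μ

/-- **The explicit double-commutator bound** (sharp hopping norm `‖c†_x c_y + c†_y c_x‖ ≤ 1`):
`‖t · T((a_x - a_y)²)‖ ≤ |t| Σ_{x,y : x∼y} (a_x - a_y)²` (ordered pairs, i.e. `2|t| Σ_bonds`).
[cite: KomaTasakiPRL1992, eq. (11)] -/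
theorem norm_smul_hoppingForm_sqGrad_le (a : Λ → ℝ) (t : ℝ) :
    ‖(t : ℂ) • hoppingForm G (fun x y => (a x - a y) ^ 2)‖ ≤
      |t| * ∑ x : Λ, ∑ y : Λ, if G.Adj x y then (a x - a y) ^ 2 else 0 := by
  rw [norm_smul, Complex.norm_real, Real.norm_eq_abs]
  refine mul_le_mul_of_nonneg_left ?_ (abs_nonneg t)
  refine (norm_hoppingForm_le_of_symm G (w := fun x y => (a x - a y) ^ 2) fun u v => by ring).trans
    (le_of_eq ?_)
  refine Finset.sum_congr rfl fun x _ => Finset.sum_congr rfl fun y _ => ?_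
  split_ifs
  · exact abs_of_nonneg (sq_nonneg _)
  · rfl

/-- **`Re ⟨[M_a, [H, M_a]]⟩_β ≤ |t| Σ_{x∼y} (a_x - a_y)²`** for the Gibbs state of `H(t,U) - μN`
at any `β`, any `U`, `μ` (states are bounded by the operator norm).
[cite: KuboKishi1990, Remark 1, eq. (4)] -/
theorem re_gibbsState_spinDensityField_doubleComm_le (a : Λ → ℝ) (t U μ β : ℝ) :
    (gibbsState β (hamiltonianWith G t U μ)
        (spinDensityField a * (hamiltonianWith G t U μ * spinDensityField a -
            spinDensityField a * hamiltonianWith G t U μ) -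
          (hamiltonianWith G t U μ * spinDensityField a -
            spinDensityField a * hamiltonianWith G t U μ) * spinDensityField a)).re ≤
      |t| * ∑ x : Λ, ∑ y : Λ, if G.Adj x y then (a x - a y) ^ 2 else 0 := by
  rw [spinDensityField_doubleComm_eq]
  refine (Complex.re_le_norm _).trans ?_
  exact (norm_gibbsState_le (isHermitian_hamiltonianWith G t U μ) β _).trans
    (norm_smul_hoppingForm_sqGrad_le G a t)

/-- **`Re ⟨[D_a, [H, D_a]]⟩_β ≤ |t| Σ_{x∼y} (a_x - a_y)²`** (charge field, any `β`, `U`, `μ`).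
[cite: KuboKishi1990, Theorem 2 and Remark 3] -/
theorem re_gibbsState_chargeDensityField_doubleComm_le (a : Λ → ℝ) (t U μ β : ℝ) :
    (gibbsState β (hamiltonianWith G t U μ)
        (chargeDensityField a * (hamiltonianWith G t U μ * chargeDensityField a -
            chargeDensityField a * hamiltonianWith G t U μ) -
          (hamiltonianWith G t U μ * chargeDensityField a -
            chargeDensityField a * hamiltonianWith G t U μ) * chargeDensityField a)).re ≤
      |t| * ∑ x : Λ, ∑ y : Λ, if G.Adj x y then (a x - a y) ^ 2 else 0 := by
  rw [chargeDensityField_doubleComm_eq]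
  refine (Complex.re_le_norm _).trans ?_
  exact (norm_gibbsState_le (isHermitian_hamiltonianWith G t U μ) β _).trans
    (norm_smul_hoppingForm_sqGrad_le G a t)

end Fields

/-! ### Fully explicit Kubo–Kishi ceilings -/

section Explicit

variable {Λ : Type} [LinearOrder Λ] [Fintype Λ] (G : SimpleGraph Λ) [DecidableRel G.Adj]

/-- Monotonicity of the Falk–Bruch right-hand side in the double-commutator slot. [folklore] -/
private theorem fb_rhs_mono {b B c c' : ℝ} (hB : 0 ≤ B) (hcc : c ≤ c') :
    b + 1 / 2 * Real.sqrt (B * c) ≤ b + 1 / 2 * Real.sqrt (B * c') := by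
  have := Real.sqrt_le_sqrt (mul_le_mul_of_nonneg_left hcc hB)
  linarith

/-- **Explicit equal-time spin fluctuations of the ATTRACTIVE model** (from the named Gaussian
domination): for `U < 0`, any `μ`, `β > 0` and every real `a`,
`⟨M_a²⟩_β ≤ ‖a‖²/(β|U|) + ½ √((‖a‖²/|U|) · |t| Σ_{x∼y} (a_x - a_y)²)`.
[cite: KuboKishi1990, Remark 1, eq. (4)] -/
theorem kuboKishi_spin_sq_le_explicit (hKK : kuboKishi_spin_gaussianDomination) {t U μ β : ℝ}
    (hU : U < 0) (hβ : 0 < β) (a : Λ → ℝ) :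
    (gibbsState β (hamiltonianWith G t U μ) (spinDensityField a * spinDensityField a)).re ≤
      (∑ x, a x ^ 2) / |U| / β +
        1 / 2 * Real.sqrt ((∑ x, a x ^ 2) / |U| *
          (|t| * ∑ x : Λ, ∑ y : Λ, if G.Adj x y then (a x - a y) ^ 2 else 0)) := by
  have h := kuboKishi_spin_falkBruch_le G hKK (t := t) (μ := μ) hU hβ (ι := Unit) (fun _ => a)
  simp only [Finset.univ_unique, Finset.sum_singleton] at h
  refine h.trans (fb_rhs_mono (div_nonneg (sum_nonneg fun x _ => sq_nonneg _) (abs_nonneg U)) ?_)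
  exact re_gibbsState_spinDensityField_doubleComm_le G a t U μ β

/-- **Explicit equal-time charge fluctuations of the REPULSIVE HALF-FILLED model on a bipartite
graph** (from the named Gaussian domination): for `U > 0`, `μ = U/2`, a bipartite sign `ε`, `β > 0`,
`⟨D_a²⟩_β ≤ ‖a‖²/(βU) + ½ √((‖a‖²/U) · |t| Σ_{x∼y} (a_x - a_y)²)`.
[cite: KuboKishi1990, Theorem 2 and Remark 3] -/
theorem kuboKishi_charge_sq_le_explicit (hKK : kuboKishi_charge_gaussianDomination) (ε : Λ → ℤˣ)
    (hε : ∀ x y, G.Adj x y → ε x = -ε y) {t U β : ℝ} (hU : 0 < U) (hβ : 0 < β) (a : Λ → ℝ) :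
    (gibbsState β (hamiltonianWith G t U (U / 2)) (chargeDensityField a * chargeDensityField a)).re ≤
      (∑ x, a x ^ 2) / U / β +
        1 / 2 * Real.sqrt ((∑ x, a x ^ 2) / U *
          (|t| * ∑ x : Λ, ∑ y : Λ, if G.Adj x y then (a x - a y) ^ 2 else 0)) := by
  have h := kuboKishi_charge_falkBruch_le G hKK ε hε (t := t) hU hβ (ι := Unit) (fun _ => a)
  simp only [Finset.univ_unique, Finset.sum_singleton] at h
  refine h.trans (fb_rhs_mono (div_nonneg (sum_nonneg fun x _ => sq_nonneg _) hU.le) ?_)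
  exact re_gibbsState_chargeDensityField_doubleComm_le G a t U (U / 2) β

/-- **Total-number fluctuations of the half-filled repulsive model are `O(T/U)` per site**:
`a ≡ 1` has no gradient, so `⟨(N - |Λ|)²⟩_β = ⟨D_1²⟩_β ≤ |Λ|/(βU)` (bipartite graph, `μ = U/2`,
`U > 0`, every `T > 0`). [cite: KuboKishi1990, Theorem 2 and Remark 3] -/
theorem kuboKishi_totalNumber_sq_le (hKK : kuboKishi_charge_gaussianDomination) (ε : Λ → ℤˣ)
    (hε : ∀ x y, G.Adj x y → ε x = -ε y) {t U β : ℝ} (hU : 0 < U) (hβ : 0 < β) :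
    (gibbsState β (hamiltonianWith G t U (U / 2))
        (chargeDensityField (fun _ : Λ => (1 : ℝ)) * chargeDensityField fun _ : Λ => (1 : ℝ))).re ≤
      (Fintype.card Λ : ℝ) / U / β := by
  have h := kuboKishi_charge_sq_le_explicit G hKK ε hε (t := t) hU hβ fun _ => (1 : ℝ)
  simp only [one_pow, Finset.sum_const, Finset.card_univ, nsmul_eq_mul, mul_one, sub_self,
    zero_pow two_ne_zero, ite_self, mul_zero, Real.sqrt_zero, add_zero] at h
  simpa using h

/-- **The staggered charge-density-wave structure factor of the half-filled repulsive model is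
`O(T/U + √(t/U))` per site** (Kubo–Kishi's Remark 3, quantitative): with `a = ε` a bipartite sign,
`(ε_x - ε_y)² = 4` on every bond, so on a graph of maximal degree `Δ`,
`⟨D_ε²⟩_β ≤ |Λ|/(βU) + ½ √((|Λ|/U) · 4|t|Δ|Λ|)`, i.e. `⟨D_ε²⟩_β/|Λ| ≤ T/U + √(Δ|t|/U)`
(`Δ = 2d` on `(ℤ/Lℤ)^d`, `L ≥ 3`). [cite: KuboKishi1990, Theorem 2 and Remark 3] -/
theorem kuboKishi_staggered_charge_sq_le (hKK : kuboKishi_charge_gaussianDomination) (ε : Λ → ℤˣ)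
    (hε : ∀ x y, G.Adj x y → ε x = -ε y) {Δ : ℕ} (hΔ : ∀ x : Λ, #{y | G.Adj x y} ≤ Δ)
    {t U β : ℝ} (hU : 0 < U) (hβ : 0 < β) :
    (gibbsState β (hamiltonianWith G t U (U / 2))
        (chargeDensityField (fun x => ((ε x : ℤ) : ℝ)) *
          chargeDensityField fun x => ((ε x : ℤ) : ℝ))).re ≤
      (Fintype.card Λ : ℝ) / U / β +
        1 / 2 * Real.sqrt ((Fintype.card Λ : ℝ) / U * (|t| * (4 * Δ * Fintype.card Λ))) := by
  have h := kuboKishi_charge_sq_le_explicit G hKK ε hε (t := t) hU hβ fun x => ((ε x : ℤ) : ℝ)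
  have hsq : ∀ x : Λ, (((ε x : ℤ) : ℝ)) ^ 2 = 1 := by
    intro x
    rcases Int.units_eq_one_or (ε x) with h1 | h1 <;> simp [h1]
  have hB : (∑ x : Λ, (((ε x : ℤ) : ℝ)) ^ 2) = Fintype.card Λ := by
    simp only [hsq, Finset.sum_const, Finset.card_univ, nsmul_eq_mul, mul_one]
  rw [hB] at h
  refine h.trans (fb_rhs_mono (div_nonneg (Nat.cast_nonneg _) hU.le)
    (mul_le_mul_of_nonneg_left ?_ (abs_nonneg t)))
  -- Σ_x Σ_y [x∼y] (ε_x - ε_y)² = Σ_x 4·deg(x) ≤ 4 Δ |Λ|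
  have hbond : ∀ x y : Λ, G.Adj x y → ((((ε x : ℤ) : ℝ)) - ((ε y : ℤ) : ℝ)) ^ 2 = 4 := by
    intro x y hxy
    rw [hε x y hxy]
    push_cast
    rcases Int.units_eq_one_or (ε y) with h1 | h1 <;> simp [h1] <;> norm_num
  calc ∑ x : Λ, ∑ y : Λ, (if G.Adj x y then ((((ε x : ℤ) : ℝ)) - ((ε y : ℤ) : ℝ)) ^ 2 else 0)
      = ∑ x : Λ, ∑ y : Λ, (if G.Adj x y then (4 : ℝ) else 0) := by
        refine Finset.sum_congr rfl fun x _ => Finset.sum_congr rfl fun y _ => ?_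
        split_ifs with hxy
        · exact hbond x y hxy
        · rfl
    _ = ∑ x : Λ, (4 : ℝ) * #{y | G.Adj x y} := by
        refine Finset.sum_congr rfl fun x _ => ?_
        rw [← Finset.sum_filter, Finset.sum_const, nsmul_eq_mul, mul_comm]
    _ ≤ ∑ _x : Λ, (4 : ℝ) * Δ := by
        refine Finset.sum_le_sum fun x _ => ?_
        exact mul_le_mul_of_nonneg_left (by exact_mod_cast hΔ x) (by norm_num)
    _ = 4 * Δ * Fintype.card Λ := by
        rw [Finset.sum_const, Finset.card_univ, nsmul_eq_mul]; ring

/-- **Staggered (`S^z` at `(π,…,π)`) spin fluctuations of the ATTRACTIVE model are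
`O(T/|U| + √(t/|U|))` per site**: `⟨M_ε²⟩_β ≤ |Λ|/(β|U|) + ½ √((|Λ|/|U|)·4|t|Δ|Λ|)` for any sign
pattern `ε` that alternates along the edges of a graph of maximal degree `Δ` (`U < 0`, any `μ`,
`T > 0`). [cite: KuboKishi1990, Remark 1, eq. (4)] -/
theorem kuboKishi_staggered_spin_sq_le (hKK : kuboKishi_spin_gaussianDomination) (ε : Λ → ℤˣ)
    (hε : ∀ x y, G.Adj x y → ε x = -ε y) {Δ : ℕ} (hΔ : ∀ x : Λ, #{y | G.Adj x y} ≤ Δ)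
    {t U μ β : ℝ} (hU : U < 0) (hβ : 0 < β) :
    (gibbsState β (hamiltonianWith G t U μ)
        (spinDensityField (fun x => ((ε x : ℤ) : ℝ)) *
          spinDensityField fun x => ((ε x : ℤ) : ℝ))).re ≤
      (Fintype.card Λ : ℝ) / |U| / β +
        1 / 2 * Real.sqrt ((Fintype.card Λ : ℝ) / |U| * (|t| * (4 * Δ * Fintype.card Λ))) := by
  have h := kuboKishi_spin_sq_le_explicit G hKK (t := t) (μ := μ) hU hβ fun x => ((ε x : ℤ) : ℝ)
  have hsq : ∀ x : Λ, (((ε x : ℤ) : ℝ)) ^ 2 = 1 := by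
    intro x
    rcases Int.units_eq_one_or (ε x) with h1 | h1 <;> simp [h1]
  have hB : (∑ x : Λ, (((ε x : ℤ) : ℝ)) ^ 2) = Fintype.card Λ := by
    simp only [hsq, Finset.sum_const, Finset.card_univ, nsmul_eq_mul, mul_one]
  rw [hB] at h
  refine h.trans (fb_rhs_mono (div_nonneg (Nat.cast_nonneg _) (abs_nonneg U))
    (mul_le_mul_of_nonneg_left ?_ (abs_nonneg t)))
  have hbond : ∀ x y : Λ, G.Adj x y → ((((ε x : ℤ) : ℝ)) - ((ε y : ℤ) : ℝ)) ^ 2 = 4 := by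
    intro x y hxy
    rw [hε x y hxy]
    push_cast
    rcases Int.units_eq_one_or (ε y) with h1 | h1 <;> simp [h1] <;> norm_num
  calc ∑ x : Λ, ∑ y : Λ, (if G.Adj x y then ((((ε x : ℤ) : ℝ)) - ((ε y : ℤ) : ℝ)) ^ 2 else 0)
      = ∑ x : Λ, ∑ y : Λ, (if G.Adj x y then (4 : ℝ) else 0) := by
        refine Finset.sum_congr rfl fun x _ => Finset.sum_congr rfl fun y _ => ?_
        split_ifs with hxy
        · exact hbond x y hxy
        · rfl
    _ = ∑ x : Λ, (4 : ℝ) * #{y | G.Adj x y} := by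
        refine Finset.sum_congr rfl fun x _ => ?_
        rw [← Finset.sum_filter, Finset.sum_const, nsmul_eq_mul, mul_comm]
    _ ≤ ∑ _x : Λ, (4 : ℝ) * Δ := by
        refine Finset.sum_le_sum fun x _ => ?_
        exact mul_le_mul_of_nonneg_left (by exact_mod_cast hΔ x) (by norm_num)
    _ = 4 * Δ * Fintype.card Λ := by
        rw [Finset.sum_const, Finset.card_univ, nsmul_eq_mul]; ring

/-- **Uniform (`q = 0`) spin fluctuations of the attractive model are `O(T/|U|)` per site**:
`⟨(N_↑ - N_↓)²⟩_β = ⟨M_1²⟩_β ≤ |Λ|/(β|U|)` (`U < 0`, any `μ`, `T > 0`; no gradient term).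
[cite: KuboKishi1990, Theorem 1, eq. (3)] -/
theorem kuboKishi_uniform_spin_sq_le (hKK : kuboKishi_spin_gaussianDomination) {t U μ β : ℝ}
    (hU : U < 0) (hβ : 0 < β) :
    (gibbsState β (hamiltonianWith G t U μ)
        (spinDensityField (fun _ : Λ => (1 : ℝ)) * spinDensityField fun _ : Λ => (1 : ℝ))).re ≤
      (Fintype.card Λ : ℝ) / |U| / β := by
  have h := kuboKishi_spin_sq_le_explicit G hKK (t := t) (μ := μ) hU hβ fun _ => (1 : ℝ)
  simp only [one_pow, Finset.sum_const, Finset.card_univ, nsmul_eq_mul, mul_one, sub_self,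
    zero_pow two_ne_zero, ite_self, mul_zero, Real.sqrt_zero, add_zero] at h
  simpa using h

end Explicit

/-! ### Two-profile families: structure-factor ceilings UNIFORM in the wave vector

For `q`-dependent structure factors one applies (A2)/(B2) to the pair of profiles
`(cos(q·x), sin(q·x))`, whose pointwise squares sum to `1`. The only input used below is that
normalisation, so the result is graph-general: for ANY two real profiles with `a_x² + b_x² = 1`,
`(a_x - a_y)² + (b_x - b_y)² ≤ 4` on every bond, hence on a graph of maximal degree `Δ`
`⟨F_a² + F_b²⟩_β ≤ |Λ|/(β|U|) + ½ √((|Λ|/|U|)·4Δ|t||Λ|)`, i.e. per site `T/|U| + √(Δ|t|/|U|)` —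
Kubo–Kishi's Remarks 1 and 3 ("no SDW / CDW order at any `q`") with one explicit, `q`-independent
finite-volume constant (`Δ = 2d` on `(ℤ/Lℤ)^d`; `4 S^{zz}_β(q)` resp. `S^{cc}_β(q)` per site). -/

section TwoProfile

variable {Λ : Type} [LinearOrder Λ] [Fintype Λ] (G : SimpleGraph Λ) [DecidableRel G.Adj]

omit [LinearOrder Λ] [Fintype Λ] in
/-- `(a_x - a_y)² + (b_x - b_y)² ≤ 4` for unit two-component profiles (Cauchy–Schwarz). [folklore] -/
private theorem sqGrad_two_le_four {a b : Λ → ℝ} (hab : ∀ x, a x ^ 2 + b x ^ 2 = 1) (x y : Λ) :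
    (a x - a y) ^ 2 + (b x - b y) ^ 2 ≤ 4 := by
  nlinarith [hab x, hab y, sq_nonneg (a x + a y), sq_nonneg (b x + b y)]

omit [LinearOrder Λ] in
/-- The summed squared gradient of a unit two-component profile over the ordered bonds of a graph of
maximal degree `Δ` is at most `4Δ|Λ|`. [folklore] -/
private theorem sum_sqGrad_two_le {a b : Λ → ℝ} (hab : ∀ x, a x ^ 2 + b x ^ 2 = 1) {Δ : ℕ}
    (hΔ : ∀ x : Λ, #{y | G.Adj x y} ≤ Δ) :
    (∑ x : Λ, ∑ y : Λ, if G.Adj x y then (a x - a y) ^ 2 else 0) +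
        ∑ x : Λ, ∑ y : Λ, (if G.Adj x y then (b x - b y) ^ 2 else 0) ≤
      4 * Δ * Fintype.card Λ := by
  calc (∑ x : Λ, ∑ y : Λ, if G.Adj x y then (a x - a y) ^ 2 else 0) +
        ∑ x : Λ, ∑ y : Λ, (if G.Adj x y then (b x - b y) ^ 2 else 0)
      = ∑ x : Λ, ∑ y : Λ, (if G.Adj x y then (a x - a y) ^ 2 + (b x - b y) ^ 2 else 0) := by
        rw [← Finset.sum_add_distrib]
        refine Finset.sum_congr rfl fun x _ => ?_
        rw [← Finset.sum_add_distrib]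
        refine Finset.sum_congr rfl fun y _ => ?_
        split_ifs <;> simp
    _ ≤ ∑ x : Λ, ∑ y : Λ, (if G.Adj x y then (4 : ℝ) else 0) := by
        refine Finset.sum_le_sum fun x _ => Finset.sum_le_sum fun y _ => ?_
        split_ifs
        · exact sqGrad_two_le_four hab x y
        · exact le_rfl
    _ = ∑ x : Λ, (4 : ℝ) * #{y | G.Adj x y} := by
        refine Finset.sum_congr rfl fun x _ => ?_
        rw [← Finset.sum_filter, Finset.sum_const, nsmul_eq_mul, mul_comm]
    _ ≤ ∑ _x : Λ, (4 : ℝ) * Δ := by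
        refine Finset.sum_le_sum fun x _ => ?_
        exact mul_le_mul_of_nonneg_left (by exact_mod_cast hΔ x) (by norm_num)
    _ = 4 * Δ * Fintype.card Λ := by
        rw [Finset.sum_const, Finset.card_univ, nsmul_eq_mul]; ring

omit [LinearOrder Λ] in
/-- `Σ_x a_x² + Σ_x b_x² = |Λ|` for unit two-component profiles. [folklore] -/
private theorem sum_sq_add_sum_sq_eq_card {a b : Λ → ℝ} (hab : ∀ x, a x ^ 2 + b x ^ 2 = 1) :
    (∑ x : Λ, a x ^ 2) + ∑ x : Λ, b x ^ 2 = Fintype.card Λ := by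
  rw [← Finset.sum_add_distrib, Finset.sum_congr rfl fun x _ => hab x, Finset.sum_const,
    Finset.card_univ, nsmul_eq_mul, mul_one]

/-- **SDW^z structure factor of the ATTRACTIVE model, uniformly in the wave vector**: for `U < 0`,
any `μ`, `β > 0`, any two real profiles with `a_x² + b_x² = 1` (e.g. `cos(q·x)`, `sin(q·x)`) on a
graph of maximal degree `Δ`,
`⟨M_a²⟩_β + ⟨M_b²⟩_β ≤ |Λ|/(β|U|) + ½ √((|Λ|/|U|)·|t|·4Δ|Λ|)`, i.e. `4 S^{zz}_β(q) ≤ T/|U| + √(Δ|t|/|U|)`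
per site for every `q`. [cite: KuboKishi1990, Theorem 1 and Remark 1, eq. (4)] -/
theorem kuboKishi_spin_twoProfile_sq_le (hKK : kuboKishi_spin_gaussianDomination) {a b : Λ → ℝ}
    (hab : ∀ x, a x ^ 2 + b x ^ 2 = 1) {Δ : ℕ} (hΔ : ∀ x : Λ, #{y | G.Adj x y} ≤ Δ)
    {t U μ β : ℝ} (hU : U < 0) (hβ : 0 < β) :
    (gibbsState β (hamiltonianWith G t U μ) (spinDensityField a * spinDensityField a)).re +
        (gibbsState β (hamiltonianWith G t U μ) (spinDensityField b * spinDensityField b)).re ≤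
      (Fintype.card Λ : ℝ) / |U| / β +
        1 / 2 * Real.sqrt ((Fintype.card Λ : ℝ) / |U| * (|t| * (4 * Δ * Fintype.card Λ))) := by
  have h := kuboKishi_spin_falkBruch_le G hKK (t := t) (μ := μ) hU hβ (ι := Fin 2) ![a, b]
  simp only [Fin.sum_univ_two, Matrix.cons_val_zero, Matrix.cons_val_one,
    sum_sq_add_sum_sq_eq_card hab] at h
  refine h.trans (fb_rhs_mono (div_nonneg (Nat.cast_nonneg _) (abs_nonneg U)) ?_)
  refine (add_le_add (re_gibbsState_spinDensityField_doubleComm_le G a t U μ β)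
    (re_gibbsState_spinDensityField_doubleComm_le G b t U μ β)).trans ?_
  rw [← mul_add]
  exact mul_le_mul_of_nonneg_left (sum_sqGrad_two_le G hab hΔ) (abs_nonneg t)

/-- **CDW structure factor of the REPULSIVE HALF-FILLED model on a bipartite graph, uniformly in
the wave vector**: for `U > 0`, `μ = U/2`, a bipartite sign `ε`, `β > 0`, any two real profiles with
`a_x² + b_x² = 1` on a graph of maximal degree `Δ`,
`⟨D_a²⟩_β + ⟨D_b²⟩_β ≤ |Λ|/(βU) + ½ √((|Λ|/U)·|t|·4Δ|Λ|)`, i.e. `S^{cc}_β(q) ≤ T/U + √(Δ|t|/U)` per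
site for every `q`. [cite: KuboKishi1990, Theorem 2 and Remark 3] -/
theorem kuboKishi_charge_twoProfile_sq_le (hKK : kuboKishi_charge_gaussianDomination) (ε : Λ → ℤˣ)
    (hε : ∀ x y, G.Adj x y → ε x = -ε y) {a b : Λ → ℝ} (hab : ∀ x, a x ^ 2 + b x ^ 2 = 1)
    {Δ : ℕ} (hΔ : ∀ x : Λ, #{y | G.Adj x y} ≤ Δ) {t U β : ℝ} (hU : 0 < U) (hβ : 0 < β) :
    (gibbsState β (hamiltonianWith G t U (U / 2)) (chargeDensityField a * chargeDensityField a)).re +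
        (gibbsState β (hamiltonianWith G t U (U / 2))
          (chargeDensityField b * chargeDensityField b)).re ≤
      (Fintype.card Λ : ℝ) / U / β +
        1 / 2 * Real.sqrt ((Fintype.card Λ : ℝ) / U * (|t| * (4 * Δ * Fintype.card Λ))) := by
  have h := kuboKishi_charge_falkBruch_le G hKK ε hε (t := t) hU hβ (ι := Fin 2) ![a, b]
  simp only [Fin.sum_univ_two, Matrix.cons_val_zero, Matrix.cons_val_one,
    sum_sq_add_sum_sq_eq_card hab] at h
  refine h.trans (fb_rhs_mono (div_nonneg (Nat.cast_nonneg _) hU.le) ?_)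
  refine (add_le_add (re_gibbsState_chargeDensityField_doubleComm_le G a t U (U / 2) β)
    (re_gibbsState_chargeDensityField_doubleComm_le G b t U (U / 2) β)).trans ?_
  rw [← mul_add]
  exact mul_le_mul_of_nonneg_left (sum_sqGrad_two_le G hab hΔ) (abs_nonneg t)

end TwoProfile

end Literature.MathematicalPhysics.QuantumLattice

end
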